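import Literature.AlgebraicGeometry.Resolution.Kuhlmann2019Prop48Setup
import Literature.AlgebraicGeometry.Resolution.Kuhlmann2019Prop49Setup
import Literature.AlgebraicGeometry.Resolution.Kuhlmann2019Lemma47
import Literature.AlgebraicGeometry.Resolution.Kuhlmann2019Prop52Reduction
import HarnessLib

/-!
# Kuhlmann 2019, Props. 4.8 / 4.9 assembled from the normal forms of Lemmas 4.2 / 4.3; Prop. 5.2 reduced to them and [23, Thm. 11.1]

Topic: `Literature/AlgebraicGeometry/Resolution` (valued function fields). Assembly layer for
the degree-`p` step `(hstep)` of `Kuhlmann2019Prop52Reduction.lean`, i.e. for Props. 4.8 /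
4.9 of F.-V. Kuhlmann, *Elimination of ramification II: Henselian rationality*, Israel J.
Math. 234 (2019) = arXiv:1701.05508 (p. 11):

> **Proposition 4.8.** Take a separably tame valued field `(K, v)` of characteristic `p > 0`
> and rank 1, an immediate transcendental extension `(K(x)|K, v)`, and a Galois extension `E`
> of `K(x)^h` of degree `p`. Then there exists `ϑ ∈ E` such that `E = K(ϑ)^h`.
> *Proof.* We can assume that (4.3) holds. Since a separably tame field is
> separable-algebraically maximal by [17, Theorem 3.10], Lemma 4.6 shows that the
> approximation type of `x` over `K` is transcendental. Because of Lemma 4.2 we can assume that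
> `ϑ^p − ϑ = g(z)`, where `g(z)` is as in (4.6) [(4.12)]. We note that `g(z) ∈ K[ϑ]`, so
> `K(g(z))^h ⊆ K(ϑ)^h`. From Lemma 4.7 we infer that `K(z)^h = K(g(z))^h`, whence
> [`E = K(x)^h(ϑ) = K(z)^h(ϑ) ⊆ K(ϑ)^h ⊆ E`].
> **Proposition 4.9.** Take an algebraically closed valued field `(K, v)` of characteristic 0
> and rank 1, an immediate transcendental extension `(K(x)|K, v)`, and a Galois extension `E`
> of `K(x)^h` of degree `p = char Kv > 0`. Then there is some `η ∈ E` such that `E = K(η)^h`.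
> *Proof.* … So we can assume that (4.4) holds. … Because of Lemma 4.3 we can assume that
> `η^p = 1 + g(z)`, where `g(z)` is as in (4.14). Again we have that `g(z) ∈ K[η]`, so
> `K(g(z))^h ⊆ K(η)^h`. From Lemma 4.7 we infer that `K(z)^h = K(g(z))^h` and conclude that
> `E = K(η)^h` as in the foregoing proof.

With (4.3) (`exists_artinSchreier_generator_eval`, `Kuhlmann2019Prop48Setup.lean`), (4.4)
(`exists_kummer_generator_one_add_eval`, `Kuhlmann2019Prop49Setup.lean`), Lemma 4.1
(`Kuhlmann2019Lemma41.lean`) and Lemma 4.7 (`henselization_closure_eval_eq`,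
`Kuhlmann2019Lemma47.lean`) PROVED in the tree, this file PROVES both assemblies, so that the
named fact `Kuhlmann2019_Prop52_sepClosed` follows from exactly three statements taken as
HYPOTHESES spelled out in the ambient rendering — the two NORMAL FORMS and [23, Thm. 11.1]:

* `(H42)` — **Lemma 4.2 as used in the proof of Prop. 4.8** (equal characteristic `p`; the
  normal form (4.12)/(4.13) with `K' = K`, legitimate over a separably tame, e.g. separably
  closed, `K`: "If `(K, v)` is perfect or separably tame, we may assume that `K' = K`"): for
  `z` transcendental over the separably closed rank-one `K` with `(K(z)|K, v)` immediate and a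
  polynomial `f` over `K`, there are `c ∈ K`, `0 ≠ d ∈ K` with `v(z̃) = 0` for
  `z̃ = (z − c)/d`, and a polynomial `g` over `K` with `f(z) − g(z̃) ∈ ℘(K(z)^h)`, whose
  non-zero coefficients `aᵢ`, `i > 0`, have `p ∤ i` and pairwise distinct values. (Of the
  printed normal form — "for all `i > 0`: `aᵢ = 0` or `vaᵢ < 0`, and `p | i ⇒ aᵢ = 0`; the
  values `vaᵢ` of all nonzero `aᵢ`, `i > 0`, are distinct" — the clause `vaᵢ < 0` is not
  needed here and not asked for.)
* `(H43)` — **Lemma 4.3 as used in the proof of Prop. 4.9** (mixed characteristic `(0, p)`):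
  for `z`, `K` as before (`K` separably closed of characteristic `0`, hence algebraically
  closed: "closed under `p`-th roots") and a polynomial `f` over `K` with `vf(z) > 0` (the
  radicand `1 + f(z)` of (4.4)), there are `c`, `d`, `z̃` as before and a polynomial `g` over
  `K` with `1 + f(z) ∈ (1 + g(z̃))·(K(z)^h)^{×p}` ("we can assume that `η^p = 1 + g(z)`")
  and an index `i₀ > 0`, `p ∤ i₀`, with `a_{i₀} ≠ 0` the unique coefficient of least value
  among `a_1,…,a_n` (printed: "there is `i₀ ∈ {1,…,n}` with `p ∤ i₀` such that `a_{i₀}` is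
  the unique coefficient of least value among `a_1,…,a_n`"; the level clause
  "`vaᵢ > (p/(p−1))vp ⇒ aᵢ = 0`" is not needed here and not asked for).
* `(hKV)` — [23, Thm. 11.1] as applied (see `Kuhlmann2019Prop52Reduction.lean`).

## Content (everything PROVED; no definition, no named fact)

* `eq_henselization_of_generator` — the common final step of both proofs: if `E = K(z)^h(θ)`
  is finite over `K(z)^h`, `K(z̃) = K(z)`, `v(z̃) = 0`, and `g` over `K` satisfies the
  hypothesis of Lemma 4.7 at `z̃` with `g(z̃) ∈ K(θ)`, then `E = K(θ)^h`.
* `prop48_of_normalForm` — **Prop. 4.8 from `(H42)`** for a separably closed rank-one `K`: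
  `ϑ' = ϑ − e` (`f(z) − g(z̃) = e^p − e`) has `ϑ'^p − ϑ' = g(z̃)`; `g` is not constant
  (else `ϑ'` would be separable over the separably closed `K`, `ϑ' ∈ K`, `E = K(z)^h`); the
  index of the coefficient of largest value is the `i₀` of Lemma 4.7.
* `prop49_of_normalForm` — **Prop. 4.9 from `(H43)`**: `η' = η/w` has `η'^p = 1 + g(z̃)`.
* `ringChar_eq_of_charP_residueField` — `char Ω ∈ {0, p}` when `char Ωv = p`.
* `Kuhlmann2019_Prop52_sepClosed.of_normalForms` — **Prop. 5.2 from `(H42)`, `(H43)`,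
  `(hKV)`** (`Kuhlmann2019_Prop52_sepClosed.of_degreeP_steps` with the case distinction on
  `char Ω`).

## Sources

* [K19] F.-V. Kuhlmann, Israel J. Math. 234 (2019) = arXiv:1701.05508: Lemmas 4.2, 4.3
  (pp. 8–9), Lemma 4.7, Props. 4.8, 4.9 (p. 11), Prop. 5.2 (p. 12). [Kuhlmann2019]
* [23] F.-V. Kuhlmann, I. Vlahu, Math. Z. 276 (2014) 203–235: Thm. 11.1 (as quoted).

## Rendering notes

As in `Kuhlmann2019Prop52Reduction.lean`, `Kuhlmann2019Prop48Setup.lean`,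
`Kuhlmann2019Prop49Setup.lean`, `Kuhlmann2019Lemma47.lean`; `℘(b) = b^p − b`;
`vz̃ = 0` ↦ `V.valuation z̃ = 1`; "least value" ↦ largest `V.valuation`.
-/

noncomputable section

namespace Literature.AlgebraicGeometry.Resolution

universe u

open Polynomial IsLocalRing IntermediateField

variable {Ω : Type u} [Field Ω] [IsAlgClosed Ω] (V : ValuationSubring Ω) (K : Subfield Ω)

/-! ### The common core of the proofs of Props. 4.8 and 4.9 -/

/-- **The common final step of Props. 4.8 / 4.9** ("We note that `g(z) ∈ K[ϑ]`, so
`K(g(z))^h ⊆ K(ϑ)^h`. From Lemma 4.7 we infer that `K(z)^h = K(g(z))^h`, whence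
`E = K(x)^h(ϑ) ⊆ K(ϑ)^h`", p. 11). Inside `(Ω, V)`: `K ≤ Ω`, `(K(z)|K, V)` immediate, `E` a
finite extension of `L = K(z)^h` generated over `L` by `θ ∈ E`; `z̃ ∈ K(z)` with `K(z̃) = K(z)`
and `v(z̃) = 1`; `g` a polynomial over `K` with `g(z̃) ∈ K(θ)` whose coefficients satisfy the
hypothesis of Lemma 4.7 (a non-zero `a_{i₀}`, `0 < i₀`, `i₀ ≠ 0` in the residue field,
dominating the other `aᵢ`, `i > 0`). Then `E = K(θ)^h`. PROVED: `L = K(z̃)^h = K(g(z̃))^h ≤ K(θ)^h`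
(Lemma 4.7, `henselization_closure_eval_eq`; `z̃v ∈ Kv` by immediateness), so
`E = L(θ) ≤ K(θ)^h`; conversely `K(θ) ≤ E` and `E` is henselian (algebraic over `L`,
`IsHenselianField.of_subfield_le`), so `K(θ)^h ≤ E`. [cite: Kuhlmann2019, Prop. 4.8 (proof)] -/
theorem eq_henselization_of_generator {z : Ω}
    (himm : IsImmediateOver V K (Subfield.closure ((K : Set Ω) ∪ {z})))
    {E : Subfield Ω} (hle : henselization V (Subfield.closure ((K : Set Ω) ∪ {z})) ≤ E)
    (hfin : 0 < Subfield.relfinrank (henselization V (Subfield.closure ((K : Set Ω) ∪ {z}))) E)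
    {θ : Ω} (hθE : θ ∈ E)
    (hEgen : E = Subfield.closure
      ((henselization V (Subfield.closure ((K : Set Ω) ∪ {z})) : Set Ω) ∪ {θ}))
    {zt : Ω} (hzt1 : V.valuation zt = 1)
    (hKzt : Subfield.closure ((K : Set Ω) ∪ {zt}) = Subfield.closure ((K : Set Ω) ∪ {z}))
    {g : Polynomial Ω} (hg : ∀ k, g.coeff k ∈ K)
    (hgθ : g.eval zt ∈ Subfield.closure ((K : Set Ω) ∪ {θ}))
    {i₀ : ℕ} (hi₀ : 0 < i₀) (hpi₀ : (i₀ : ResidueField V) ≠ 0) (ha : g.coeff i₀ ≠ 0)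
    (hdom : ∀ i, 0 < i → i ≠ i₀ → V.valuation (g.coeff i) < V.valuation (g.coeff i₀)) :
    E = henselization V (Subfield.closure ((K : Set Ω) ∪ {θ})) := by
  classical
  set Kz : Subfield Ω := Subfield.closure ((K : Set Ω) ∪ {z}) with hKzdef
  set L : Subfield Ω := henselization V Kz with hLdef
  set Kθ : Subfield Ω := Subfield.closure ((K : Set Ω) ∪ {θ}) with hKθdef
  have hKKz : K ≤ Kz := fun c hc => Subfield.subset_closure (Or.inl hc)
  have hKKθ : K ≤ Kθ := fun c hc => Subfield.subset_closure (Or.inl hc)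
  have hθKθ : θ ∈ Kθ := Subfield.subset_closure (Or.inr rfl)
  have hKzL : Kz ≤ L := le_henselization V Kz
  have hLh : IsHenselianField L (V.comap (algebraMap L Ω)) :=
    Kuhlmann2010HenselizationIsHenselian_holds Ω V Kz
  -- `z̃ ∈ K(z)` has residue in `Kv`
  have hztKz : zt ∈ Kz := hKzt ▸ Subfield.subset_closure (Or.inr rfl)
  have hztV : zt ∈ V := (V.valuation_le_one_iff zt).mp hzt1.le
  have hzres : ∃ c ∈ K, V.valuation (zt - c) < 1 := by
    have hr : residue V ⟨zt, hztV⟩ ∈ resField V K := himm.2 (residue_mem_resField V ⟨zt, hztV⟩ hztKz)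
    obtain ⟨c, hcK, hc⟩ := (mem_resField_iff V K _).mp hr
    refine ⟨c, hcK, ?_⟩
    have h0 : residue V (⟨zt, hztV⟩ - c) = 0 := by rw [map_sub, hc, sub_self]
    exact (ValuationSubring.valuation_lt_one_iff V (⟨zt, hztV⟩ - c)).mp ((residue_eq_zero_iff _).mp h0)
  -- Lemma 4.7: `L = K(z̃)^h = K(g(z̃))^h ≤ K(θ)^h`
  have h47 : henselization V (Subfield.closure ((K : Set Ω) ∪ {g.eval zt})) =
      henselization V (Subfield.closure ((K : Set Ω) ∪ {zt})) :=
    henselization_closure_eval_eq V hzt1 hzres hg hi₀ hpi₀ ha hdom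
  have hLle : L ≤ henselization V Kθ := by
    have hLeq : L = henselization V (Subfield.closure ((K : Set Ω) ∪ {g.eval zt})) := by
      rw [hLdef, ← hKzt, h47]
    rw [hLeq]
    exact henselization_mono V Kuhlmann2010HenselizationIsHenselian_holds
      (Subfield.closure_le.mpr (Set.union_subset hKKθ (Set.singleton_subset_iff.mpr hgθ)))
  apply le_antisymm
  · rw [hEgen]
    exact Subfield.closure_le.mpr (Set.union_subset hLle
      (Set.singleton_subset_iff.mpr (le_henselization V Kθ hθKθ)))
  · -- `E` is henselian, being finite over `L`
    have halg : ∀ a ∈ E, IsAlgebraic L a := by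
      intro a ha
      haveI : FiniteDimensional L (Subfield.extendScalars hle) := by
        rw [Subfield.relfinrank_eq_finrank_of_le hle] at hfin
        exact Module.finite_of_finrank_pos hfin
      have h1 : IsAlgebraic L (⟨a, ha⟩ : Subfield.extendScalars hle) :=
        Algebra.IsAlgebraic.isAlgebraic _
      exact IntermediateField.isAlgebraic_iff.mp h1
    have hEh : IsHenselianField E (V.comap (algebraMap E Ω)) := hLh.of_subfield_le V hle halg
    exact henselization_le_of_isHenselianField V Kθ
      (Subfield.closure_le.mpr (Set.union_subset (hKKz.trans (hKzL.trans hle))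
        (Set.singleton_subset_iff.mpr hθE))) hEh

/-! ### Prop. 4.8 from the normal form of Lemma 4.2 -/

/-- **Kuhlmann 2019, Prop. 4.8 from the normal form `(H42)` of Lemma 4.2**, for `K ≤ Ω`
separably closed of rank one in characteristic `p` (module docstring): every Galois extension
`E` of degree `p` of `K(z)^h`, `z` transcendental with `(K(z)|K, v)` immediate, is `K(ϑ)^h`
for some `ϑ ∈ E`. PROVED from (4.3), `(H42)`, Lemma 4.7. [cite: Kuhlmann2019, Prop. 4.8] -/
theorem prop48_of_normalForm {p : ℕ} [Fact p.Prime] [CharP Ω p] [CharP (ResidueField V) p]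
    [IsSepClosed K] (hr : IsRankOne V K)
    (H42 : ∀ (z : Ω), Transcendental K z →
      IsImmediateOver V K (Subfield.closure ((K : Set Ω) ∪ {z})) →
      ∀ f : Polynomial Ω, (∀ k, f.coeff k ∈ K) →
      ∃ c ∈ K, ∃ d ∈ K, d ≠ 0 ∧ V.valuation ((z - c) / d) = 1 ∧
      ∃ g : Polynomial Ω, (∀ k, g.coeff k ∈ K) ∧
        (∃ e ∈ henselization V (Subfield.closure ((K : Set Ω) ∪ {z})),
          f.eval z - g.eval ((z - c) / d) = e ^ p - e) ∧
        (∀ i, 0 < i → g.coeff i ≠ 0 → ¬ p ∣ i) ∧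
        (∀ i j, 0 < i → 0 < j → i ≠ j → g.coeff i ≠ 0 → g.coeff j ≠ 0 →
          V.valuation (g.coeff i) ≠ V.valuation (g.coeff j)))
    {z : Ω} (hz : Transcendental K z)
    (himm : IsImmediateOver V K (Subfield.closure ((K : Set Ω) ∪ {z})))
    {E : Subfield Ω} (hE : IsGaloisStep p (henselization V (Subfield.closure ((K : Set Ω) ∪ {z}))) E) :
    ∃ ϑ ∈ E, E = henselization V (Subfield.closure ((K : Set Ω) ∪ {ϑ})) := by
  classical
  have hp : p.Prime := Fact.out
  set Kz : Subfield Ω := Subfield.closure ((K : Set Ω) ∪ {z}) with hKzdef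
  set L : Subfield Ω := henselization V Kz with hLdef
  have hKKz : K ≤ Kz := fun c hc => Subfield.subset_closure (Or.inl hc)
  have hzKz : z ∈ Kz := Subfield.subset_closure (Or.inr rfl)
  have hKzL : Kz ≤ L := le_henselization V Kz
  obtain ⟨hle, hdeg, -⟩ := id hE
  have hfin : 0 < Subfield.relfinrank L E := by
    rw [Subfield.relfinrank_eq_finrank_of_le hle, hdeg]
    exact hp.pos
  -- (4.3): an Artin–Schreier generator with polynomial right-hand side
  obtain ⟨ϑ, hϑE, f, hf, hϑeq, hEgen⟩ := exists_artinSchreier_generator_eval V K hz himm hr hE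
  -- Lemma 4.2: the normal form
  obtain ⟨c, hcK, d, hdK, hd0, hvzt, g, hg, ⟨e, heL, hfg⟩, hcond, hdist⟩ := H42 z hz himm f hf
  set zt : Ω := (z - c) / d with hztdef
  -- the new generator `ϑ' = ϑ − e`
  set ϑ' : Ω := ϑ - e with hϑ'def
  have hϑ'E : ϑ' ∈ E := sub_mem hϑE (hle heL)
  have hϑ'eq : ϑ' ^ p - ϑ' = g.eval zt := by
    rw [hϑ'def, sub_pow_char]
    have h1 : ϑ ^ p - e ^ p - (ϑ - e) = (ϑ ^ p - ϑ) - (e ^ p - e) := by ring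
    rw [h1, hϑeq, ← hfg]
    ring
  have hEgen' : E = Subfield.closure ((L : Set Ω) ∪ {ϑ'}) := by
    rw [hEgen]
    have h1 : L⟮ϑ - e⟯ = L⟮ϑ⟯ :=
      Literature.FieldTheory.ArtinSchreier.adjoin_simple_sub_algebraMap (F := L) (E := Ω) ϑ ⟨e, heL⟩
    have h2 := congrArg IntermediateField.toSubfield h1
    rw [adjoin_toSubfield_eq_closure, adjoin_toSubfield_eq_closure] at h2
    exact h2.symm
  -- `K(z̃) = K(z)`
  have hKzt : Subfield.closure ((K : Set Ω) ∪ {zt}) = Kz := by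
    apply le_antisymm
    · refine Subfield.closure_le.mpr (Set.union_subset hKKz (Set.singleton_subset_iff.mpr ?_))
      exact div_mem (sub_mem hzKz (hKKz hcK)) (hKKz hdK)
    · refine Subfield.closure_le.mpr (Set.union_subset
        (fun b hb => Subfield.subset_closure (Or.inl hb)) (Set.singleton_subset_iff.mpr ?_))
      have hz' : z = d * zt + c := by
        rw [hztdef]
        field_simp
        ring
      rw [hz']
      exact add_mem (mul_mem (Subfield.subset_closure (Or.inl hdK))
        (Subfield.subset_closure (Or.inr rfl))) (Subfield.subset_closure (Or.inl hcK))
  -- `g(z̃) = ϑ'^p − ϑ' ∈ K(ϑ')`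
  have hgθ : g.eval zt ∈ Subfield.closure ((K : Set Ω) ∪ {ϑ'}) := by
    rw [← hϑ'eq]
    have hm : ϑ' ∈ Subfield.closure ((K : Set Ω) ∪ {ϑ'}) := Subfield.subset_closure (Or.inr rfl)
    exact sub_mem (pow_mem hm p) hm
  -- `g` is not constant (else `ϑ'` would be separable-algebraic over `K`, i.e. in `K`)
  have hnc : ∃ i, 0 < i ∧ g.coeff i ≠ 0 := by
    by_contra hall
    push Not at hall
    have hg0 : g.eval zt = g.coeff 0 := by
      rw [eval_eq_sum_range, Finset.sum_range_succ', pow_zero, mul_one,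
        Finset.sum_eq_zero fun k _ => by rw [hall (k + 1) (Nat.succ_pos k), zero_mul], zero_add]
    have hϑ'K : ϑ' ∈ K := by
      haveI : CharP K p := (algebraMap K Ω).charP Subtype.val_injective p
      set a₀ : K := ⟨g.coeff 0, hg 0⟩ with ha₀def
      set P : Polynomial K := X ^ p - X - C a₀ with hPdef
      have hder : derivative P = -1 := by
        rw [hPdef, derivative_sub, derivative_sub, derivative_X_pow, derivative_X, derivative_C,
          CharP.cast_eq_zero K p, C_0, zero_mul, zero_sub, sub_zero]
      have hPsep : P.Separable := by
        rw [Polynomial.separable_def']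
        exact ⟨0, -1, by rw [hder]; ring⟩
      have hPϑ : aeval ϑ' P = 0 := by
        rw [hPdef, map_sub, map_sub, map_pow, aeval_X, aeval_C, hϑ'eq, hg0]
        exact sub_self _
      have hP0 : P ≠ 0 := fun h0 => by
        have := congrArg derivative h0
        rw [hder, derivative_zero] at this
        exact neg_ne_zero.mpr one_ne_zero this
      have halgϑ : IsAlgebraic K ϑ' := ⟨P, hP0, hPϑ⟩
      have hint : IsIntegral K ϑ' := halgϑ.isIntegral
      have hsepϑ : IsSeparable K ϑ' := hPsep.of_dvd (minpoly.dvd K ϑ' hPϑ)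
      have hdeg1 := IsSepClosed.degree_eq_one_of_irreducible K (minpoly.irreducible hint) hsepϑ
      obtain ⟨r, hr'⟩ := minpoly.mem_range_of_degree_eq_one K ϑ' hdeg1
      rw [← hr']
      exact r.2
    have hEL : E = L := by
      rw [hEgen']
      exact le_antisymm (Subfield.closure_le.mpr (Set.union_subset le_rfl
        (Set.singleton_subset_iff.mpr (hKzL (hKKz hϑ'K)))))
        (fun b hb => Subfield.subset_closure (Or.inl hb))
    have h1 : Subfield.relfinrank L E = 1 := by rw [hEL, Subfield.relfinrank_self]
    rw [Subfield.relfinrank_eq_finrank_of_le hle, hdeg] at h1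
    exact hp.one_lt.ne' h1
  -- the dominant index `i₀`
  set S : Finset ℕ := (Finset.range (g.natDegree + 1)).filter fun i => 0 < i ∧ g.coeff i ≠ 0
    with hSdef
  have hSmem : ∀ i, 0 < i → g.coeff i ≠ 0 → i ∈ S := fun i hi hgi =>
    Finset.mem_filter.mpr ⟨Finset.mem_range.mpr (Nat.lt_succ_of_le (le_natDegree_of_ne_zero hgi)),
      hi, hgi⟩
  have hSne : S.Nonempty := by
    obtain ⟨i, hi, hgi⟩ := hnc
    exact ⟨i, hSmem i hi hgi⟩
  obtain ⟨i₀, hi₀S, hmax⟩ := Finset.exists_max_image S (fun i => V.valuation (g.coeff i)) hSne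
  obtain ⟨-, hi₀, ha⟩ := Finset.mem_filter.mp hi₀S
  have hpi₀ : (i₀ : ResidueField V) ≠ 0 := by
    rw [Ne, CharP.cast_eq_zero_iff (ResidueField V) p]
    exact hcond i₀ hi₀ ha
  have hdom : ∀ i, 0 < i → i ≠ i₀ → V.valuation (g.coeff i) < V.valuation (g.coeff i₀) := by
    intro i hi hii
    by_cases hgi : g.coeff i = 0
    · rw [hgi, map_zero]
      exact (Valuation.pos_iff _).mpr ha
    · exact lt_of_le_of_ne (hmax i (hSmem i hi hgi)) (hdist i i₀ hi hi₀ hii hgi ha)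
  exact ⟨ϑ', hϑ'E, eq_henselization_of_generator V K himm hle hfin hϑ'E hEgen' hvzt hKzt hg hgθ
    hi₀ hpi₀ ha hdom⟩

/-! ### Prop. 4.9 from the normal form of Lemma 4.3 -/

/-- **Kuhlmann 2019, Prop. 4.9 from the normal form `(H43)` of Lemma 4.3**, for `K ≤ Ω`
separably closed of rank one, `char Ω = 0`, `char Ωv = p` (module docstring): every Galois
extension `E` of degree `p` of `K(z)^h`, `z` transcendental with `(K(z)|K, v)` immediate, is
`K(η)^h` for some `η ∈ E`. PROVED from (4.4), `(H43)`, Lemma 4.7. [cite: Kuhlmann2019, Prop. 4.9] -/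
theorem prop49_of_normalForm {p : ℕ} [Fact p.Prime] [CharZero Ω] [CharP (ResidueField V) p]
    [IsSepClosed K] (hr : IsRankOne V K)
    (H43 : ∀ (z : Ω), Transcendental K z →
      IsImmediateOver V K (Subfield.closure ((K : Set Ω) ∪ {z})) →
      ∀ f : Polynomial Ω, (∀ k, f.coeff k ∈ K) → V.valuation (f.eval z) < 1 →
      ∃ c ∈ K, ∃ d ∈ K, d ≠ 0 ∧ V.valuation ((z - c) / d) = 1 ∧
      ∃ g : Polynomial Ω, (∀ k, g.coeff k ∈ K) ∧
        (∃ w ∈ henselization V (Subfield.closure ((K : Set Ω) ∪ {z})), w ≠ 0 ∧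
          1 + f.eval z = (1 + g.eval ((z - c) / d)) * w ^ p) ∧
        (∃ i₀, 0 < i₀ ∧ ¬ p ∣ i₀ ∧ g.coeff i₀ ≠ 0 ∧
          ∀ i, 0 < i → i ≠ i₀ → V.valuation (g.coeff i) < V.valuation (g.coeff i₀)))
    {z : Ω} (hz : Transcendental K z)
    (himm : IsImmediateOver V K (Subfield.closure ((K : Set Ω) ∪ {z})))
    {E : Subfield Ω} (hE : IsGaloisStep p (henselization V (Subfield.closure ((K : Set Ω) ∪ {z}))) E) :
    ∃ η ∈ E, E = henselization V (Subfield.closure ((K : Set Ω) ∪ {η})) := by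
  classical
  have hp : p.Prime := Fact.out
  set Kz : Subfield Ω := Subfield.closure ((K : Set Ω) ∪ {z}) with hKzdef
  set L : Subfield Ω := henselization V Kz with hLdef
  have hKKz : K ≤ Kz := fun c hc => Subfield.subset_closure (Or.inl hc)
  have hzKz : z ∈ Kz := Subfield.subset_closure (Or.inr rfl)
  have hKzL : Kz ≤ L := le_henselization V Kz
  obtain ⟨hle, hdeg, -⟩ := id hE
  have hfin : 0 < Subfield.relfinrank L E := by
    rw [Subfield.relfinrank_eq_finrank_of_le hle, hdeg]
    exact hp.pos
  -- (4.4): a Kummer generator with radicand `1 + f(z)`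
  obtain ⟨η, hηE, f, hf, hvf, hηp, hEgen⟩ := exists_kummer_generator_one_add_eval V K hz himm hr hE
  -- Lemma 4.3: the normal form
  obtain ⟨c, hcK, d, hdK, hd0, hvzt, g, hg, ⟨w, hwL, hw0, hrel⟩, i₀, hi₀, hpi₀', ha, hdom⟩ :=
    H43 z hz himm f hf hvf
  set zt : Ω := (z - c) / d with hztdef
  -- the new generator `η' = η / w`
  set η' : Ω := w⁻¹ * η with hη'def
  have hη'E : η' ∈ E := mul_mem (hle (L.inv_mem hwL)) hηE
  have hη'p : η' ^ p = 1 + g.eval zt := by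
    have hwp0 : w ^ p ≠ 0 := pow_ne_zero p hw0
    rw [hη'def, mul_pow, hηp, hrel, inv_pow]
    field_simp
  have hEgen' : E = Subfield.closure ((L : Set Ω) ∪ {η'}) := by
    rw [hEgen]
    have h1 : L⟮w⁻¹ * η⟯ = L⟮η⟯ := adjoin_simple_mul_of_mem (L.inv_mem hwL) (inv_ne_zero hw0) η
    have h2 := congrArg IntermediateField.toSubfield h1
    rw [adjoin_toSubfield_eq_closure, adjoin_toSubfield_eq_closure] at h2
    exact h2.symm
  -- `K(z̃) = K(z)`
  have hKzt : Subfield.closure ((K : Set Ω) ∪ {zt}) = Kz := by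
    apply le_antisymm
    · refine Subfield.closure_le.mpr (Set.union_subset hKKz (Set.singleton_subset_iff.mpr ?_))
      exact div_mem (sub_mem hzKz (hKKz hcK)) (hKKz hdK)
    · refine Subfield.closure_le.mpr (Set.union_subset
        (fun b hb => Subfield.subset_closure (Or.inl hb)) (Set.singleton_subset_iff.mpr ?_))
      have hz' : z = d * zt + c := by
        rw [hztdef]
        field_simp
        ring
      rw [hz']
      exact add_mem (mul_mem (Subfield.subset_closure (Or.inl hdK))
        (Subfield.subset_closure (Or.inr rfl))) (Subfield.subset_closure (Or.inl hcK))
  -- `g(z̃) = η'^p − 1 ∈ K(η')`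
  have hgθ : g.eval zt ∈ Subfield.closure ((K : Set Ω) ∪ {η'}) := by
    have h1 : g.eval zt = η' ^ p - 1 := by rw [hη'p]; ring
    rw [h1]
    have hm : η' ∈ Subfield.closure ((K : Set Ω) ∪ {η'}) := Subfield.subset_closure (Or.inr rfl)
    exact sub_mem (pow_mem hm p) (Subfield.one_mem _)
  have hpi₀ : (i₀ : ResidueField V) ≠ 0 := by
    rw [Ne, CharP.cast_eq_zero_iff (ResidueField V) p]
    exact hpi₀'
  exact ⟨η', hη'E, eq_henselization_of_generator V K himm hle hfin hη'E hEgen' hvzt hKzt hg hgθ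
    hi₀ hpi₀ ha hdom⟩

/-! ### Characteristic bookkeeping: `char Ω ∈ {0, p}` -/

omit [IsAlgClosed Ω] in
/-- If the residue field of `V` has prime characteristic `p` and `Ω` has characteristic `q ≠ 0`,
then `q = p`. [folklore] -/
theorem ringChar_eq_of_charP_residueField {p : ℕ} (hp : p.Prime) [CharP (ResidueField V) p]
    {q : ℕ} [hq : CharP Ω q] (hq0 : q ≠ 0) : q = p := by
  have hqprime : q.Prime := CharP.char_prime_of_ne_zero Ω hq0
  have h1 : ((q : V) : Ω) = 0 := by
    push_cast
    exact CharP.cast_eq_zero Ω q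
  have h2 : (q : V) = 0 := Subtype.ext h1
  have h3 : (q : ResidueField V) = 0 := by
    rw [← map_natCast (residue V) q, h2, map_zero]
  have h4 : p ∣ q := (CharP.cast_eq_zero_iff (ResidueField V) p q).mp h3
  exact ((Nat.prime_dvd_prime_iff_eq hp hqprime).mp h4).symm

/-! ### Prop. 5.2 from the normal forms of Lemmas 4.2 / 4.3 and [23, Thm. 11.1] -/

/-- **Kuhlmann 2019, Prop. 5.2 from the normal forms of Lemmas 4.2 / 4.3 and [23, Thm. 11.1].**
The named fact `Kuhlmann2019_Prop52_sepClosed` follows from `(H42)`, `(H43)` and `(hKV)`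
(module docstring), everything else in the printed proofs of Prop. 5.2, Props. 4.8/4.9,
Lemmas 4.1, 4.7, 5.1, 5.4 being PROVED in the tree: `Kuhlmann2019_Prop52_sepClosed.of_degreeP_steps`
with `(hstep)` supplied by `prop48_of_normalForm` / `prop49_of_normalForm` according to
`char Ω ∈ {p, 0}` (`ringChar_eq_of_charP_residueField`). [cite: Kuhlmann2019, Prop. 5.2] -/
theorem Kuhlmann2019_Prop52_sepClosed.of_normalForms
    (H42 : ∀ (Ω : Type u) [Field Ω] [IsAlgClosed Ω] (V : ValuationSubring Ω) (p : ℕ) [Fact p.Prime]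
      [CharP Ω p] [CharP (ResidueField V) p] (K : Subfield Ω), IsSepClosed K → IsRankOne V K →
      ∀ (z : Ω), Transcendental K z →
      IsImmediateOver V K (Subfield.closure ((K : Set Ω) ∪ {z})) →
      ∀ f : Polynomial Ω, (∀ k, f.coeff k ∈ K) →
      ∃ c ∈ K, ∃ d ∈ K, d ≠ 0 ∧ V.valuation ((z - c) / d) = 1 ∧
      ∃ g : Polynomial Ω, (∀ k, g.coeff k ∈ K) ∧
        (∃ e ∈ henselization V (Subfield.closure ((K : Set Ω) ∪ {z})),
          f.eval z - g.eval ((z - c) / d) = e ^ p - e) ∧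
        (∀ i, 0 < i → g.coeff i ≠ 0 → ¬ p ∣ i) ∧
        (∀ i j, 0 < i → 0 < j → i ≠ j → g.coeff i ≠ 0 → g.coeff j ≠ 0 →
          V.valuation (g.coeff i) ≠ V.valuation (g.coeff j)))
    (H43 : ∀ (Ω : Type u) [Field Ω] [IsAlgClosed Ω] (V : ValuationSubring Ω) (p : ℕ) [Fact p.Prime]
      [CharZero Ω] [CharP (ResidueField V) p] (K : Subfield Ω), IsSepClosed K → IsRankOne V K →
      ∀ (z : Ω), Transcendental K z →
      IsImmediateOver V K (Subfield.closure ((K : Set Ω) ∪ {z})) →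
      ∀ f : Polynomial Ω, (∀ k, f.coeff k ∈ K) → V.valuation (f.eval z) < 1 →
      ∃ c ∈ K, ∃ d ∈ K, d ≠ 0 ∧ V.valuation ((z - c) / d) = 1 ∧
      ∃ g : Polynomial Ω, (∀ k, g.coeff k ∈ K) ∧
        (∃ w ∈ henselization V (Subfield.closure ((K : Set Ω) ∪ {z})), w ≠ 0 ∧
          1 + f.eval z = (1 + g.eval ((z - c) / d)) * w ^ p) ∧
        (∃ i₀, 0 < i₀ ∧ ¬ p ∣ i₀ ∧ g.coeff i₀ ≠ 0 ∧
          ∀ i, 0 < i → i ≠ i₀ → V.valuation (g.coeff i) < V.valuation (g.coeff i₀)))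
    (hKV : ∀ (Ω : Type u) [Field Ω] [IsAlgClosed Ω] (V : ValuationSubring Ω)
      (K F : Subfield Ω) (y : Ω), IsSepClosed K → IsRankOne V K → K ≤ F → FGOver K F →
      SeparablyGeneratedOver K F →
      (∃ x ∈ F, Transcendental K x ∧
        ∀ z ∈ F, IsAlgebraic (IntermediateField.adjoin K ({x} : Set Ω)) z) →
      IsImmediateOver V K F → y ∈ henselization V F → Transcendental K y →
      F ≤ henselization V (Subfield.closure ((K : Set Ω) ∪ {y})) →
      ∃ y' ∈ F, Transcendental K y' ∧
        F ≤ henselization V (Subfield.closure ((K : Set Ω) ∪ {y'}))) :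
    Kuhlmann2019_Prop52_sepClosed.{u} := by
  refine Kuhlmann2019_Prop52_sepClosed.of_degreeP_steps (fun Ω _ _ V p _ hp K y E hK hr hy himm hgal => ?_) hKV
  haveI : Fact p.Prime := ⟨hp⟩
  haveI : IsSepClosed K := hK
  obtain ⟨q, hq⟩ := CharP.exists Ω
  by_cases hq0 : q = 0
  · subst hq0
    haveI : CharZero Ω := CharP.charP_to_charZero Ω
    exact prop49_of_normalForm V K hr (H43 := H43 Ω V p K hK hr) (hz := hy) (himm := himm)
      (hE := hgal)
  · have hqp : q = p := ringChar_eq_of_charP_residueField V hp hq0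
    subst hqp
    exact prop48_of_normalForm V K hr (H42 := H42 Ω V q K hK hr) (hz := hy) (himm := himm)
      (hE := hgal)

end Literature.AlgebraicGeometry.Resolution

end
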